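import Summits.BirchSwinnertonDyer.Rank1Residual.WAll.TargetAdditiveAtThreePotSSImage
import HarnessLib
import HarnessLib.Audit.Tags

/-!
# Rung W-ALL of ladder BSD (D-0120) — row 2 at `p = 3`, block A: the IRREDUCIBLE atoms by local type
# (wild / tame), for a route on the wild rank-one leaf (cell `bsd-wall`, lane (2), seat `bsd-wall-ty-1`;
# new small file importing `WAll.TargetAdditiveAtThreePotSSImage`, which is at the 400-line proof-file cap)

HONEST FRAMING (cell `bsd-wall`, run/shared/lean/pub/bsd-wall/; brief `WALL-BRIEF-v1.md` sha16
b966bf16da27706e §2): STATEMENTS AND BOOKKEEPING ONLY — nothing asserted, nothing booked, no named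
fact, no published theorem restated; the two `@[conjecture] def`s below are OPEN obligations and SLICES
of the registered leaves `WAllExclAddWildRankOne` / `WAllExclAddTameSSAtThreeRankOne`
(`TargetAdditiveAtThreeCells.lean`) and of the irreducible block `WAllExclAddPotSSAtThreeRankOneIrr`
(`TargetAdditiveAtThreePotSSImage.lean` §1, = A2 ∪ A3 of the census dossier
`bsd-wall-census/BLOCK-A-R1POTSS3-DOSSIER-v1.md` rev 2 ffc5ad03e4723116).

WHY. The lane-3 seat `bsd-wall-pss3` typed its first crux (STATUS 2026-08-27T07:35:23Z) as a route draft
«UniversalToricDescent» ON THE WILD RANK-ONE LEAF `WAllExclAddWildRankOne` (`13 573` classes): transport of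
the split anticyclotomic main-conjecture equality along `E′[3] ≅ E[3]` from a semistable-at-`3` twin —
a lever that needs `E[3]` irreducible (director-bsd 2026-08-27T07:25:28Z (3): scope endorsed = onto +
Cartan-normaliser images). The image file cuts block A (tame ∪ wild) by image and each image block by
type, but not each TYPE leaf into reducible ∧ irreducible; this file adds exactly that:
`WAllExclAddWildRankOneIrr` (W/onto `3 894` + W/3Nn `193` + W/3Ns `110` = `4 197` classes of record) and
`WAllExclAddTameSSAtThreeRankOneIrr`, and PROVES by case split only: wild r1 ⟺ wild-reducible ∧
wild-irreducible (so a route on the irreducible atom leaves exactly the LANDED reducible atom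
`WAllExclAddWildRankOneRed` named), tame likewise, irreducible block ⟺ tame-irr ∧ wild-irr, each
irreducible atom ⇐ its onto and normaliser atoms (and conversely given «onto ⇒ irreducible», displayed
as `hsi` and discharged by the tree theorem
`Literature.NumberTheory.EllipticCurves.hasIrreducibleModPGaloisRep_of_hasSurjectiveModNGaloisRep`, not
imported), everything ⇐ `WAllExclX4` ⇐ … and ⇐ `WAll`; §2 reassembles the registered slice `WAllExclAdditiveAtThree`
from either menu (image-keyed / wild-keyed / type-keyed) so the leaf registry
`Rank1Residual.WAll.wAll_of_slicedLeaves_primaryGZ` consumes the new leaves by name.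

References: `WAll/TargetAdditiveAtThreePotSSImage.lean`, `WAll/TargetAdditiveAtThreePotSS.lean`,
`WAll/TargetAdditiveAtThreeCells.lean`; `Rank1Residual/Predicates.lean` (`Irr`, `Red`, `Surj`); HOME
`bsd-wall-census/BLOCK-A-R1POTSS3-DOSSIER-v1.md` §1/§6; [cite: Miller2011LMS, §1 and Def. 1.1] (the
currency `BSD(E,p)`).
-/

noncomputable section

open scoped Classical

open WeierstrassCurve Literature.NumberTheory.EllipticCurves
  Literature.NumberTheory.EllipticCurves.Rank1Residual Literature.NumberTheory.EllipticCurves.ModularForms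
open Summit.BirchSwinnertonDyer.Rank1Residual

set_option autoImplicit false

namespace Summit.BirchSwinnertonDyer

/-! ### §1. The irreducible atoms by local type (wild / tame) and their glue -/

/-- **Wild additive `3`, irreducible `E[3]`, rank one (OPEN)**: non-CM, `Additive.ClassO6 W 3`, `Irr W 3`,
`r = 1` ⇒ `BSD(E,3)` — the irreducible part of `WAllExclAddWildRankOne` (dossier §1: W/onto `3 894` +
W/3Nn `193` + W/3Ns `110` = `4 197` classes), i.e. the habitat of a mod-`3` congruence / deformation
transport from a semistable-at-`3` twin (seat `bsd-wall-pss3`, route draft «UniversalToricDescent» on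
the leaf `WAllExclAddWildRankOne`, STATUS 2026-08-27T07:35:23Z), whose complement inside the wild
rank-one cell is the reducible atom `WAllExclAddWildRankOneRed`. [folklore] -/
@[conjecture] def WAllExclAddWildRankOneIrr : Prop :=
  ∀ (W : WeierstrassCurve ℚ) [W.IsElliptic] [W.IsGloballyMinimal],
    ¬ W.HasCM → Additive.ClassO6 W 3 → Irr W 3 → W.analyticRank = 1 → BSDp W 3

/-- Tame potentially supersingular additive `3` (`Additive.ClassO5 W 3`), irreducible `E[3]`, rank one
(OPEN): the irreducible part of `WAllExclAddTameSSAtThreeRankOne` (T′/onto `731` + T′/3Nn `97` +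
`(G) ∧ ss` irreducible share). [folklore] -/
@[conjecture] def WAllExclAddTameSSAtThreeRankOneIrr : Prop :=
  ∀ (W : WeierstrassCurve ℚ) [W.IsElliptic] [W.IsGloballyMinimal],
    ¬ W.HasCM → Additive.ClassO5 W 3 → Irr W 3 → W.analyticRank = 1 → BSDp W 3

/-- **Wild rank one ⟺ wild-reducible ∧ wild-irreducible** (excluded middle on `Irr W 3`): a route on
`WAllExclAddWildRankOneIrr` leaves exactly `WAllExclAddWildRankOneRed` named. [folklore] -/
theorem wAllExclAddWildRankOne_iff_red_irr :
    WAllExclAddWildRankOne ↔ WAllExclAddWildRankOneRed ∧ WAllExclAddWildRankOneIrr :=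
  ⟨fun h ↦ ⟨fun W _ _ hcm hO _ hr ↦ h W hcm hO hr, fun W _ _ hcm hO _ hr ↦ h W hcm hO hr⟩,
    fun ⟨hR, hI⟩ W _ _ hcm hO hr ↦ by
      by_cases hirr : Irr W 3
      · exact hI W hcm hO hirr hr
      · exact hR W hcm hO hirr hr⟩

/-- Tame rank one at `3` ⟺ tame-reducible ∧ tame-irreducible. [folklore] -/
theorem wAllExclAddTameSSAtThreeRankOne_iff_red_irr :
    WAllExclAddTameSSAtThreeRankOne ↔
      WAllExclAddTameSSAtThreeRankOneRed ∧ WAllExclAddTameSSAtThreeRankOneIrr :=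
  ⟨fun h ↦ ⟨fun W _ _ hcm hO _ hr ↦ h W hcm hO hr, fun W _ _ hcm hO _ hr ↦ h W hcm hO hr⟩,
    fun ⟨hR, hI⟩ W _ _ hcm hO hr ↦ by
      by_cases hirr : Irr W 3
      · exact hI W hcm hO hirr hr
      · exact hR W hcm hO hirr hr⟩

/-- The irreducible block A2 ∪ A3 ⟺ its tame and wild atoms. [folklore] -/
theorem wAllExclAddPotSSAtThreeRankOneIrr_iff :
    WAllExclAddPotSSAtThreeRankOneIrr ↔
      WAllExclAddTameSSAtThreeRankOneIrr ∧ WAllExclAddWildRankOneIrr :=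
  ⟨fun h ↦ ⟨fun W _ _ hcm hO hi hr ↦ h W hcm (Or.inl hO) hi hr,
      fun W _ _ hcm hO hi hr ↦ h W hcm (Or.inr hO) hi hr⟩,
    fun ⟨h5, h6⟩ W _ _ hcm hO hi hr ↦
      hO.elim (fun hO ↦ h5 W hcm hO hi hr) (fun hO ↦ h6 W hcm hO hi hr)⟩

/-- Wild-irreducible ⇐ wild-onto ∧ wild-normaliser (excluded middle on `Surj W 3`). [folklore] -/
theorem wAllExclAddWildRankOneIrr_of_surj_of_irrNotSurj (hS : WAllExclAddWildRankOneSurj)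
    (hN : WAllExclAddWildRankOneIrrNotSurj) : WAllExclAddWildRankOneIrr := fun W _ _ hcm hO hirr hr ↦ by
  by_cases hs : Surj W 3
  · exact hS W hcm hO hs hr
  · exact hN W hcm hO hirr hs hr

/-- Wild-irreducible restricts to wild-normaliser, and — given «onto ⇒ irreducible» (`hsi`) — to
wild-onto. [folklore] -/
theorem wAllExclAddWildRankOneIrr_iff_surj_irrNotSurj
    (hsi : ∀ (W : WeierstrassCurve ℚ) [W.IsElliptic], Surj W 3 → Irr W 3) :
    WAllExclAddWildRankOneIrr ↔ WAllExclAddWildRankOneSurj ∧ WAllExclAddWildRankOneIrrNotSurj :=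
  ⟨fun h ↦ ⟨fun W _ _ hcm hO hs hr ↦ h W hcm hO (hsi W hs) hr,
      fun W _ _ hcm hO hirr _ hr ↦ h W hcm hO hirr hr⟩,
    fun ⟨hS, hN⟩ ↦ wAllExclAddWildRankOneIrr_of_surj_of_irrNotSurj hS hN⟩

/-- Tame-irreducible ⇐ tame-onto ∧ tame-normaliser. [folklore] -/
theorem wAllExclAddTameSSAtThreeRankOneIrr_of_surj_of_irrNotSurj (hS : WAllExclAddTameSSAtThreeRankOneSurj)
    (hN : WAllExclAddTameSSAtThreeRankOneIrrNotSurj) : WAllExclAddTameSSAtThreeRankOneIrr :=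
  fun W _ _ hcm hO hirr hr ↦ by
    by_cases hs : Surj W 3
    · exact hS W hcm hO hs hr
    · exact hN W hcm hO hirr hs hr

/-- The two irreducible atoms ⇐ the irreducible block ⇐ block A ⇐ `WAll`; and ⇐ `WAllExclX4`.
[folklore] -/
theorem irrAtoms_of_wAllExclAddPotSSAtThreeRankOneIrr (h : WAllExclAddPotSSAtThreeRankOneIrr) :
    WAllExclAddTameSSAtThreeRankOneIrr ∧ WAllExclAddWildRankOneIrr :=
  wAllExclAddPotSSAtThreeRankOneIrr_iff.1 h

/-- Wild-irreducible ⇐ the registered sub-leaf `WAllExclX4`. [folklore] -/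
theorem wAllExclAddWildRankOneIrr_of_wAllExclX4 (h : WAllExclX4) : WAllExclAddWildRankOneIrr :=
  (irrAtoms_of_wAllExclAddPotSSAtThreeRankOneIrr (wAllExclAddPotSSAtThreeRankOneIrr_of_wAllExclX4 h)).2

/-- Wild-irreducible ⇐ `WAll`. [folklore] -/
theorem wAllExclAddWildRankOneIrr_of_wAll (h : WAll) : WAllExclAddWildRankOneIrr :=
  (irrAtoms_of_wAllExclAddPotSSAtThreeRankOneIrr (potSSAtThreeRankOneImages_of_wAll h).2.1).2

/-- **The wild rank-one leaf from a route on its irreducible part plus the reducible atom** (the form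
the pss3 route's `closes` can cite if it re-targets to `WAllExclAddWildRankOneIrr`). [folklore] -/
theorem wAllExclAddWildRankOne_of_red_of_irr (hR : WAllExclAddWildRankOneRed)
    (hI : WAllExclAddWildRankOneIrr) : WAllExclAddWildRankOne :=
  wAllExclAddWildRankOne_iff_red_irr.2 ⟨hR, hI⟩

/-! ### §2. Row 2 at `3` reassembled from the new leaves (registry keys; no mathematics) -/

/-- **Row 2 at `3` (`WAllExclAdditiveAtThree`, registered slice) ⇐ the K1 cells (M)@3 and (G-ord)@3
(rank `≤ 1`), the rank-`0` potentially supersingular block, A1 (reducible) and A2 ∪ A3 (irreducible)** —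
the image-keyed menu: with `WAllExclAddPotSSAtThreeRankOneIrr` LOADED (2026-08-27T07:47Z) a route on it
plus these named leaves feeds `Rank1Residual.WAll.wAll_of_slicedLeaves_primaryGZ` by name. [folklore] -/
theorem wAllExclAdditiveAtThree_of_k1Cells_of_potSSRankZero_of_red_of_irr
    (hM : WAllExclAddPotMultAtThree) (hG : WAllExclAddPotOrdAtThree) (h0 : WAllExclAddPotSSAtThreeRankZero)
    (hR : WAllExclAddPotSSAtThreeRankOneRed) (hI : WAllExclAddPotSSAtThreeRankOneIrr) :
    WAllExclAdditiveAtThree :=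
  wAllExclAdditiveAtThree_of_potMult_potOrd_potSS hM hG
    (wAllExclAddPotSSAtThree_iff_ranks.2 ⟨h0, wAllExclAddPotSSAtThreeRankOne_of_red_of_irr hR hI⟩)

/-- The same keyed to the three image walls A1, A2, A3. [folklore] -/
theorem wAllExclAdditiveAtThree_of_k1Cells_of_potSSRankZero_of_images
    (hM : WAllExclAddPotMultAtThree) (hG : WAllExclAddPotOrdAtThree) (h0 : WAllExclAddPotSSAtThreeRankZero)
    (hR : WAllExclAddPotSSAtThreeRankOneRed) (hS : WAllExclAddPotSSAtThreeRankOneSurj)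
    (hN : WAllExclAddPotSSAtThreeRankOneIrrNotSurj) : WAllExclAdditiveAtThree :=
  wAllExclAdditiveAtThree_of_k1Cells_of_potSSRankZero_of_red_of_irr hM hG h0 hR
    (wAllExclAddPotSSAtThreeRankOneIrr_of_surj_of_irrNotSurj hS hN)

/-- **Row 2 at `3` ⇐ the wild-keyed menu** (pss3 option (b)): (M)@3, (G-ord)@3, the rank-`0`
potentially supersingular block, the tame rank-one leaf O5@3.r1, the wild-reducible atom and the
wild-irreducible atom. [folklore] -/
theorem wAllExclAdditiveAtThree_of_k1Cells_of_potSSRankZero_of_tame_of_wildRed_of_wildIrr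
    (hM : WAllExclAddPotMultAtThree) (hG : WAllExclAddPotOrdAtThree) (h0 : WAllExclAddPotSSAtThreeRankZero)
    (hT : WAllExclAddTameSSAtThreeRankOne) (hWR : WAllExclAddWildRankOneRed)
    (hWI : WAllExclAddWildRankOneIrr) : WAllExclAdditiveAtThree :=
  wAllExclAdditiveAtThree_of_potMult_potOrd_potSS hM hG
    (wAllExclAddPotSSAtThree_iff_ranks.2
      ⟨h0, wAllExclAddPotSSAtThreeRankOne_iff.2 ⟨hT, wAllExclAddWildRankOne_of_red_of_irr hWR hWI⟩⟩)

/-- **Row 2 at `3`, rank one ⇐ the type-keyed menu** (pss3 option (a)): (M)@3.r1, (G-ord)@3.r1, O5@3.r1,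
wild-reducible, wild-irreducible. [folklore] -/
theorem wAllExclAdditiveAtThreeRankOne_of_cells_of_wildRed_of_wildIrr
    (hM : WAllExclAddPotMultAtThreeRankOne) (hG : WAllExclAddPotOrdAtThreeRankOne)
    (hT : WAllExclAddTameSSAtThreeRankOne) (hWR : WAllExclAddWildRankOneRed)
    (hWI : WAllExclAddWildRankOneIrr) : WAllExclAdditiveAtThreeRankOne :=
  wAllExclAdditiveAtThreeRankOne_iff_cells.2 ⟨hM, hG, hT, wAllExclAddWildRankOne_of_red_of_irr hWR hWI⟩

/-- Conversely row 2 at `3` restricts to every leaf of both menus (each is an instance). [folklore] -/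
theorem irrMenus_of_wAllExclAdditiveAtThree (h : WAllExclAdditiveAtThree) :
    WAllExclAddPotSSAtThreeRankOneRed ∧ WAllExclAddPotSSAtThreeRankOneIrr ∧
      WAllExclAddWildRankOneRed ∧ WAllExclAddWildRankOneIrr ∧
        WAllExclAddTameSSAtThreeRankOneRed ∧ WAllExclAddTameSSAtThreeRankOneIrr := by
  have hA : WAllExclAddPotSSAtThreeRankOne :=
    (wAllExclAddPotSSAtThree_iff_ranks.1 (wAllExclAdditiveAtThree_iff_potMult_potOrd_potSS.1 h).2.2).2
  obtain ⟨hR, hI⟩ := wAllExclAddPotSSAtThreeRankOne_iff_red_irr.1 hA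
  obtain ⟨hTI, hWI⟩ := wAllExclAddPotSSAtThreeRankOneIrr_iff.1 hI
  obtain ⟨hTR, hWR⟩ := wAllExclAddPotSSAtThreeRankOneRed_iff.1 hR
  exact ⟨hR, hI, hWR, hWI, hTR, hTI⟩

end Summit.BirchSwinnertonDyer

end
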